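import Summits.KontsevichZagierPeriods.KontsevichZagierPeriods.Theorems.SoloInformedKZPOneKCharts
import HarnessLib
import HarnessLib.Audit

/-!
# SoloInformed — values of one-variable rational integrals with real algebraic coefficients: Baker normal form, algebraic values, vanishing values

Solo programme `solo-KontsevichZagierPeriods-informed`, session s112, file 19.

Corollaries of `soloInformed_segSpan_of_isKRationalOne` (file 18) read through the normal form of
the span of points and segments (file 7, `soloInformed_segNF_of_mem_segSpan`):

* `soloInformed_exists_value_eq_baker_K` — **census of values**: every absolutely convergent
  `∫_D N/M dx` (`N, M ∈ K[x]`, `K` the real algebraic numbers, `M ≠ 0` on the `ℚ`-semialgebraic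
  `D ⊆ ℝ`) equals `a + Σ_k Re(g_k · Log c_k)` with `a` real algebraic, `g_k, c_k` complex algebraic,
  `c_k` in the slit plane (principal logarithm) — an element of Baker's module;
* `soloInformed_mem_relations_of_value_eq_zero_K` — a member of the class with value `0` IS a
  relation (`[D, N/M] ∈ relations`);
* `soloInformed_equivalent_ptRep_of_isAlgebraic_value_K` — a member whose value is an algebraic
  number `a` is KZ-equivalent to the point representation `[pt, a]` ("accessible identities":
  every algebraic evaluation of such an integral is proved by the three moves);
* `soloInformed_equivalent_segRep_of_value_eq_K` — a member whose value is `Re(g · Log c)` is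
  KZ-equivalent to the single segment `Seg(g, c)`.

References: A. Baker, *Transcendental Number Theory* (1975), Thm. 2.1; M. Kontsevich, D. Zagier,
*Periods* (2001), §1.1–1.2.
-/

noncomputable section

open scoped BigOperators Polynomial

namespace Summit.KontsevichZagierPeriods.KontsevichZagierPeriods.Theorems

open Set MeasureTheory
open Literature.ModelTheory.ExponentialFields
open Literature.NumberTheory.Transcendental Literature.NumberTheory.Transcendental.KZ

/-- **Census of values (Baker normal form).** The value of a member of the `K`-rational class of
dimension `1` is `a + Σ_k Re(g_k Log c_k)` with `a` real algebraic and `g_k, c_k` algebraic, `c_k` in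
the slit plane. [Baker 1975, Thm. 2.1 (shape of the module); this work] -/
theorem soloInformed_exists_value_eq_baker_K (r : IntegralRep 1) (hr : SoloInformedIsKRationalOne r) :
    ∃ (a : ℝ) (_ : IsAlgebraic ℚ a) (A : ℕ) (g c : Fin A → ℂ),
      (∀ k, IsAlgebraic ℚ (g k) ∧ IsAlgebraic ℚ (c k) ∧ c k ∈ Complex.slitPlane) ∧
      r.value = a + ∑ k, (g k * Complex.log (c k)).re := by
  obtain ⟨a, ha, A, g, c, hadm, hrel⟩ :=
    soloInformed_segNF_of_mem_segSpan (soloInformed_segSpan_of_isKRationalOne r hr)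
  refine ⟨a, ha, A, g, c, fun k => hadm k, ?_⟩
  have h0 : eval (of r - (of (soloInformedPtRep a ha) + ∑ k, of (soloInformedSegRep (g k) (c k)))) =
      0 := relations_le_ker_eval_holds hrel
  rw [map_sub, soloInformed_eval_ptRep_add_sum ha hadm, eval_of, sub_eq_zero] at h0
  exact h0

/-- **Vanishing value ⇒ relation.** [this work] -/
theorem soloInformed_mem_relations_of_value_eq_zero_K (r : IntegralRep 1)
    (hr : SoloInformedIsKRationalOne r) (h0 : r.value = 0) : of r ∈ relations :=
  soloInformed_mem_relations_of_mem_segSpan (soloInformed_segSpan_of_isKRationalOne r hr)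
    (by rw [eval_of, h0])

/-- **Algebraic value ⇒ equivalent to a point.** If `∫_D N/M dx = a` is an algebraic number then
`[D, N/M]` and the point representation `[pt, a]` are connected by the three moves.
[Kontsevich–Zagier 2001, §1.2 ("accessible identities"); this work] -/
theorem soloInformed_equivalent_ptRep_of_isAlgebraic_value_K (r : IntegralRep 1)
    (hr : SoloInformedIsKRationalOne r) (ha : IsAlgebraic ℚ r.value) :
    Equivalent r (soloInformedPtRep r.value ha) :=
  soloInformed_equivalent_of_mem_segSpan (soloInformed_segSpan_of_isKRationalOne r hr)
    (soloInformed_ptRep_mem_segSpan r.value ha) (by rw [soloInformed_value_ptRep])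

/-- **Logarithmic value ⇒ equivalent to one segment.** If `∫_D N/M dx = Re(g · Log c)` with `g, c`
algebraic, `c` in the slit plane, then `[D, N/M]` is KZ-equivalent to the segment `Seg(g, c)`
(e.g. `∫_D N/M = log 2` ⇒ equivalent to `∫_0^1 dx/(1+x)`). [this work] -/
theorem soloInformed_equivalent_segRep_of_value_eq_K (r : IntegralRep 1)
    (hr : SoloInformedIsKRationalOne r) {g c : ℂ} (hadm : SoloInformedSegAdm g c)
    (hv : r.value = (g * Complex.log c).re) :
    Equivalent r (soloInformedSegRep g c) :=
  soloInformed_equivalent_of_mem_segSpan (soloInformed_segSpan_of_isKRationalOne r hr)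
    (soloInformed_segRep_mem_segSpan hadm) (by rw [soloInformed_value_segRep hadm, hv])

/-- **Two members with values differing by an algebraic number.** If `value r − value r' = a` is
algebraic then `[r] − [r'] − [pt, a] ∈ relations`. [this work] -/
theorem soloInformed_sub_sub_ptRep_mem_relations_K (r r' : IntegralRep 1)
    (hr : SoloInformedIsKRationalOne r) (hr' : SoloInformedIsKRationalOne r')
    {a : ℝ} (ha : IsAlgebraic ℚ a) (hv : r.value - r'.value = a) :
    of r - of r' - of (soloInformedPtRep a ha) ∈ relations :=
  soloInformed_mem_relations_of_mem_segSpan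
    (sub_mem (sub_mem (soloInformed_segSpan_of_isKRationalOne r hr)
      (soloInformed_segSpan_of_isKRationalOne r' hr')) (soloInformed_ptRep_mem_segSpan a ha))
    (by rw [map_sub, map_sub, eval_of, eval_of, eval_of, soloInformed_value_ptRep, hv, sub_self])

end Summit.KontsevichZagierPeriods.KontsevichZagierPeriods.Theorems
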